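import Summits.NavierStokesRegularity.NavierStokesRegularity.Theorems.CoriolisHeadTypeIRateOfSummableModulus
import HarnessLib

/-!
# CoriolisHeadTypeIRateOfScaleNaturalDecaySummable — crux `NoCoRotatingCore` (stmt-NavierStokesRegularity-22676),
# line `far_field_constancy` v2 (skeleton 15c9a82ad206abb9): **K1a_Σ ⟹ K1c verbatim** (third door, ready to paste)

For the planner (ns-idea-10).  `typeIRate_of_summable_modulus` (landed) closes K1c under a square-summable dyadic
modulus for the first derivative.  This file states that hypothesis as a closed statement about ALL bounded smooth
div-free rotated Leray profiles — K1a_Σ: «there is a nonincreasing `θ` with bounded partial sums such that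
`‖y‖²‖DU(y)‖² ≤ θ_i` for `‖y‖ ≥ 2^i`» (a quantitative companion of the registered K1a; e.g. any modulus
`‖y‖‖DU(y)‖ ≲ (log ‖y‖)^{−1/2−κ}`) — and proves `stub_typeIRate_of_scaleNaturalDecay_summable`:
**K1a_Σ ⟹ the registered signature of `stub_typeIRate` VERBATIM**.  Together with
`stub_typeIRate_of_scaleNaturalDecay_three` (K1a₃ ⟹ K1c) the planner has two paste-ready restatements of the line's
analytic crux under which K1b (landed) and K1c (landed reductions) close.  HONEST FRAMING: K1a_Σ is OPEN (it contains a
quantitative form of K1a, the hard core); nothing here proves K1c as registered, `NoCoRotatingCore` or NS regularity.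

References: skeleton `Cruxes/NoCoRotatingCore/Lines/far_field_constancy.lean` (stubs K1a, K1c); B. Pineau, V. Vicol,
arXiv:2607.09619 (2026), Conj. 1.1, Prop. 3.1 [PineauVicol2026].
-/

noncomputable section

open Set Function Filter Topology Metric InnerProductSpace Real
open scoped RealInnerProductSpace BigOperators Laplacian ContDiff

-- the summit and its single sub-problem share the name (CONVENTIONS §1), as in every Theorems file
set_option linter.dupNamespace false

namespace Summit.NavierStokesRegularity.NavierStokesRegularity.Theorems.CoriolisHead

namespace TypeIRate

open Literature.Analysis.FluidPDE

/-- **K1a_Σ ⟹ K1c, both verbatim.**  IF every bounded smooth div-free rotated Leray profile admits a square-summable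
dyadic modulus for its first derivative (K1a_Σ), THEN the registered signature of `stub_typeIRate` (K1c) holds as printed
(`typeIRate_of_summable_modulus`, the modulus of the given profile being read off from K1a_Σ).  K1a_Σ is OPEN; this is
a reduction, not a proof of K1c. [cite: PineauVicol2026, Conj. 1.1] -/
theorem stub_typeIRate_of_scaleNaturalDecay_summable
    (hK1aS : ∀ (ν a : ℝ), 0 < ν → 0 < a →
      ∀ (B : EuclideanSpace ℝ (Fin 3) →L[ℝ] EuclideanSpace ℝ (Fin 3))
        (U : EuclideanSpace ℝ (Fin 3) → EuclideanSpace ℝ (Fin 3)) (P : EuclideanSpace ℝ (Fin 3) → ℝ),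
      ContDiff ℝ (⊤ : ℕ∞) U → ContDiff ℝ 2 P → (∀ x, inner ℝ (B x) x = 0) →
      Literature.Analysis.FluidPDE.VectorCalculus.IsDivFree U →
      (∀ y, -(ν • Laplacian.laplacian U y) + a • U y + a • fderiv ℝ U y y
        + (B (U y) - fderiv ℝ U y (B y)) + Literature.Analysis.FluidPDE.convect U U y
        + gradient P y = 0) →
      (∃ M : ℝ, ∀ y, ‖U y‖ ≤ M) →
      ∃ (θ : ℕ → ℝ) (Θ : ℝ), Antitone θ ∧ (∀ n, ∑ i ∈ Finset.range n, θ i ≤ Θ) ∧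
        ∀ (i : ℕ) (y : EuclideanSpace ℝ (Fin 3)), (2 : ℝ) ^ i ≤ ‖y‖ → ‖y‖ ^ 2 * ‖fderiv ℝ U y‖ ^ 2 ≤ θ i) :
    ∀ (ν a : ℝ), 0 < ν → 0 < a →
      ∀ (B : EuclideanSpace ℝ (Fin 3) →L[ℝ] EuclideanSpace ℝ (Fin 3))
        (U : EuclideanSpace ℝ (Fin 3) → EuclideanSpace ℝ (Fin 3)) (P : EuclideanSpace ℝ (Fin 3) → ℝ),
      ContDiff ℝ (⊤ : ℕ∞) U → ContDiff ℝ 2 P → (∀ x, inner ℝ (B x) x = 0) →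
      Literature.Analysis.FluidPDE.VectorCalculus.IsDivFree U →
      (∀ y, -(ν • Laplacian.laplacian U y) + a • U y + a • fderiv ℝ U y y
        + (B (U y) - fderiv ℝ U y (B y)) + Literature.Analysis.FluidPDE.convect U U y
        + gradient P y = 0) →
      (∃ M : ℝ, ∀ y, ‖U y‖ ≤ M) →
      (∀ ε : ℝ, 0 < ε → ∃ R : ℝ, ∀ y, R ≤ ‖y‖ →
        ‖y‖ * ‖fderiv ℝ U y‖ + ‖y‖ ^ 2 * ‖iteratedFDeriv ℝ 2 U y‖ ≤ ε) →
      ∀ b : EuclideanSpace ℝ (Fin 3), (∀ ε : ℝ, 0 < ε → ∃ R : ℝ, ∀ y, R ≤ ‖y‖ → ‖U y - b‖ ≤ ε) →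
      ∃ K : ℝ, ∀ y, ‖U y - b‖ ≤ K / (1 + ‖y‖) := by
  intro ν a hν ha B U P hU hP hB hdiv heq hbdd hdecay b hlim
  exact typeIRate_of_summable_modulus hν ha hB hU hP hdiv heq hbdd hdecay b hlim
    (hK1aS ν a hν ha B U P hU hP hB hdiv heq hbdd)

end TypeIRate

end Summit.NavierStokesRegularity.NavierStokesRegularity.Theorems.CoriolisHead

end
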